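import Literature.AlgebraicGeometry.Resolution.RegularLocalRingsProofs
import Mathlib.RingTheory.Regular.RegularSequence
import Mathlib.RingTheory.Localization.AtPrime.Basic
import Mathlib.RingTheory.Localization.Ideal
import Mathlib.RingTheory.Finiteness.Ideal
import Mathlib.RingTheory.Ideal.MinimalPrime.Basic
import HarnessLib

/-!
# Ogoma's lemma and the choice of parameters at `𝔮` (Stacks 07FC, 07FD)

Topic: `Literature/AlgebraicGeometry/Resolution`. First support file of the INLINE proof of the
named fact `Stacks07FE_resolveSpecial` (Stacks, *Smoothing Ring Maps*, Lemma 07FE) vendored in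
`NeronPopescuSteps.lean`: the two lemmas of Stacks, Section 07FB ("Separable residue fields")
that precede 07FE, both PROVED here, sorry-free, with no new named fact.

* `exists_mem_smul_ann_eq_ann_sq` — **Ogoma's lemma** (Stacks, Lemma 07FC): `A` Noetherian,
  `M` a finite `A`-module, `S ⊆ A` multiplicative, `π ∈ A`; if `Ker(π : S⁻¹M → S⁻¹M) =
  Ker(π² : S⁻¹M → S⁻¹M)` then there is `s ∈ S` such that for every `n > 0`,
  `Ker(sⁿπ : M → M) = Ker((sⁿπ)² : M → M)`. The localisation hypothesis and conclusion are
  written elementwise (`∃ s ∈ S, s • (π² • m) = 0 → ∃ s ∈ S, s • (π • m) = 0`), which is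
  literally the statement about `S⁻¹M` unfolded, so that no model of `S⁻¹M` has to be chosen.
* `exists_parameters_pow_mem_ann_eq` — **Stacks, Lemma 07FD**: `Λ` Noetherian, `I, 𝔮 ⊆ Λ`
  ideals with `𝔮` prime, `n, e > 0`, `𝔮ⁿΛ_𝔮 ⊆ IΛ_𝔮`, `Λ_𝔮` a regular local ring of dimension `d`;
  then there are `π₁, …, π_d ∈ Λ` with (1) `(π₁, …, π_d)Λ_𝔮 = 𝔮Λ_𝔮`, (2) `πᵢⁿ ∈ I`, and (3)
  `Ann_{Λ/(π₁ᵉ,…,πᵢ₋₁ᵉ)Λ}(πᵢ) = Ann_{Λ/(π₁ᵉ,…,πᵢ₋₁ᵉ)Λ}(πᵢ²)` for all `i` (the printed proof keeps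
  the same `n`, and so do we). Indices run over `Fin d`, condition (3) being stated in colon
  form `πᵢ² y ∈ Jᵢ → πᵢ y ∈ Jᵢ`, `Jᵢ = (πⱼᵉ : j < i)`.
* `pow_mul_mem_imp_of_sq` — the remark used in the proof of 07FE: if
  `Ann(π) = Ann(π²)` modulo `J` then `Ann(π) = Ann(πᶜ)` for every `c > 0`.
* `isWeaklyRegular_cons_pow`, `isWeaklyRegular_map_pow_append` — powers of (an initial segment
  of) a weakly regular sequence in `𝔪` over a Noetherian local ring stay weakly regular
  (Matsumura, Thm. 16.1, in the generality needed here); `mem_span_pow_of_mul_mem` — in a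
  regular local ring with regular system of parameters `x₁, …, x_d`, `x_t` is a non-zero-divisor
  modulo `(xⱼᵉ : j < t)`.
* `exists_pow_map_le_map_of_mem_minimalPrimes` — the first line of the proof of 07FE: if `𝔮` is
  minimal over `𝔥` then `𝔮ⁿΛ_𝔮 ⊆ 𝔥Λ_𝔮` for some `n > 0` (the hypothesis of 07FD).

## The printed proofs (Stacks, chapter 07BW version ed88ff78, p. 24) and their formalisation

* 07FC: "Let `K = Ker(π : M → M)`, `K′ = {m ∈ M | π²m = 0 in S⁻¹M}`, `Q = K′/K`. `S⁻¹Q = 0` by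
  assumption; `Q` is finite as `A` is Noetherian, so some `s ∈ S` annihilates `Q`. Then `s`
  works." We take generators of the Noetherian submodule `K′`, kill each by an element of `S`
  (this is `s K′ ⊆ Ker(π)`, slightly more than `sQ = 0`, exactly as the hypothesis provides) and
  multiply; the final sentence is the computation `(sⁿπ)²m = 0 ⇒ m ∈ K′ ⇒ sπm = 0 ⇒ sⁿπm = 0`.
* 07FD: "(1): pick `π₁, …, π_d` generating `𝔮Λ_𝔮` (regularity); (2): `πᵢⁿ ∈ IΛ_𝔮`, so `sᵢπᵢⁿ ∈ I`
  for some `sᵢ ∈ S`, replace `πᵢ` by `sᵢπᵢ`; (1), (2) are stable under further multiplication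
  by elements of `S`; (3) by induction on `t`: `π₁, …, π_d` is a regular sequence in `Λ_𝔮`
  (Algebra, Lemma 106.3 — here `isRegular_of_span_eq_maximalIdeal` of
  `RegularLocalRingsProofs.lean`, Matsumura Thm. 17.8), hence so is `π₁ᵉ, …, π_tᵉ, π_{t+1}`
  (Algebra, Lemma 68.9; Matsumura Thm. 16.1 — powers and permutations, from Mathlib's
  `IsLocalRing.isWeaklyRegular_of_perm_of_subset_maximalIdeal` and `IsSMulRegular.pow`), so
  `Ann(π_{t+1}) = Ann(π_{t+1}²)` in `S⁻¹(Λ/(π₁ᵉ, …, π_tᵉ))`, and Ogoma's lemma gives `s ∈ S` with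
  (3) for `sπ_{t+1}`." The regularity is transported from `Λ_𝔮` back to `Λ` up to elements of
  `S` (`exists_mul_mem_of_regular_atPrime`), which is exactly the hypothesis of 07FC.

## Roadmap (the rest of the inline proof of `Stacks07FE_resolveSpecial`, review 2026-08-15)

The printed proof of 07FE (pp. 24–25) needs, besides this file: Elkik's strictly standard
elements (07C7, 07ET, 07CA, 07CC) and Lemma 07EZ (e); the presentation `C = Sym*_B(I/I²)` of
07CE with `Ω_{C_a/R}` free; standard smooth refinements 07CG/07CH/07CI/07EY; the lifting
problem 07CK/07CL/07CM; the lifting lemma 07CP (with 07C6); the desingularization lemmas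
07CR/07CT/07F0; the local tricks 07F8/07F9/07FA; flatness of `k[x]_(x) → Λ_𝔮` by the local
criterion (`Literature.RingTheory.Flat.LocalCriterion`); and Algebra 07BV in factorisation form
(a separable `κ(𝔮)/k` receives every finitely presented `k`-algebra through a smooth one). All
of these are to be PROVED as theorems in sibling files (no further named facts, D-0026); the
smoothness claims of 07CP/07CR are reachable by the Jacobian criterion (`Algebra.IsStandardSmooth`)
and Mathlib's `Algebra.Smooth.of_formallySmooth_fiber`, `Algebra.Etale.of_formallyUnramified_of_flat`,
`Algebra.IsSmoothAt.exists_notMem_isStandardSmooth`, without the fibrewise flatness criterion.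

## Sources

* The Stacks Project, *Smoothing Ring Maps* (Tag 07BW), Section 07FB: Lemma 07FC (Ogoma),
  Lemma 07FD, and the first lines of the proof of Lemma 07FE. [StacksProject]
* T. Ogoma, *General Néron desingularization based on the idea of Popescu*, J. Algebra 167
  (1994) 57–84 (the source of 07FC, via Swan's exposition). Cited through Stacks.
* H. Matsumura, *Commutative Ring Theory*, CUP 1986, Thm. 17.8 (book p. 137: a regular
  system of parameters is an `A`-sequence), Thm. 16.1 (book p. 123, PDF p. 139: "If `a₁, …, a_n`
  is an `M`-sequence then so is `a₁^{ν₁}, …, a_n^{ν_n}`"). [Matsumura1987]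
-/

namespace Literature.AlgebraicGeometry.Resolution

universe u v

open IsLocalRing RingTheory.Sequence

/-! ## Ogoma's lemma (Stacks 07FC) -/

section Ogoma

variable {A : Type u} [CommRing A]

/-- **Ogoma's lemma** (Stacks, Lemma 07FC). Let `A` be a Noetherian ring, `M` a finite
`A`-module, `S ⊆ A` a multiplicative subset and `π ∈ A`. If `Ker(π : S⁻¹M → S⁻¹M) =
Ker(π² : S⁻¹M → S⁻¹M)` — elementwise: whenever `sπ²m = 0` for some `s ∈ S` then `s′πm = 0` for
some `s′ ∈ S` — then there exists `s ∈ S` such that for every `n > 0` we have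
`Ker(sⁿπ : M → M) = Ker((sⁿπ)² : M → M)`. [cite: StacksProject, Tag 07FC] -/
theorem exists_mem_smul_ann_eq_ann_sq [IsNoetherianRing A] {M : Type v} [AddCommGroup M]
    [Module A M] [Module.Finite A M] (S : Submonoid A) (π : A)
    (h : ∀ m : M, (∃ s ∈ S, s • ((π * π) • m) = 0) → ∃ s ∈ S, s • (π • m) = 0) :
    ∃ s ∈ S, ∀ n : ℕ, 0 < n → ∀ m : M,
      (s ^ n * π) • ((s ^ n * π) • m) = 0 → (s ^ n * π) • m = 0 := by
  classical
  -- `K' = {m ∈ M | π² m = 0 in S⁻¹M}`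
  let K' : Submodule A M :=
    { carrier := {m | ∃ s ∈ S, s • ((π * π) • m) = 0}
      add_mem' := by
        rintro a b ⟨s, hs, ha⟩ ⟨t, ht, hb⟩
        refine ⟨t * s, S.mul_mem ht hs, ?_⟩
        rw [smul_add, smul_add, mul_smul t s, mul_smul t s, ha, smul_zero, zero_add,
          smul_comm t s, hb, smul_zero]
      zero_mem' := ⟨1, S.one_mem, by simp⟩
      smul_mem' := by
        rintro c m ⟨s, hs, hm⟩
        refine ⟨s, hs, ?_⟩
        rw [smul_comm (π * π) c m, smul_comm s c, hm, smul_zero] }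
  obtain ⟨T, hT⟩ : K'.FG := IsNoetherian.noetherian K'
  have hgen : ∀ m ∈ T, ∃ s ∈ S, s • (π • m) = 0 := fun m hm =>
    h m (show m ∈ K' from hT ▸ Submodule.subset_span hm)
  choose! σ hσS hσ using hgen
  set s : A := ∏ m ∈ T, σ m with hs_def
  have hsS : s ∈ S := S.prod_mem fun m hm => hσS m hm
  -- `s` kills `π K'`
  have hkill : ∀ m ∈ K', s • (π • m) = 0 := by
    intro m hm
    rw [← hT] at hm
    refine Submodule.span_induction ?_ ?_ ?_ ?_ hm
    · intro m hmT
      obtain ⟨u, hu⟩ : σ m ∣ s := Finset.dvd_prod_of_mem σ hmT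
      rw [hu, mul_comm, mul_smul, hσ m hmT, smul_zero]
    · simp
    · intro a b _ _ ha hb
      rw [smul_add, smul_add, ha, hb, add_zero]
    · intro c m _ hm
      rw [smul_comm π c, smul_comm s c, hm, smul_zero]
  refine ⟨s, hsS, fun n hn m hm => ?_⟩
  -- `(sⁿπ)² m = 0` puts `m` in `K'`
  have hmK : m ∈ K' := by
    refine ⟨s ^ n * s ^ n, S.mul_mem (S.pow_mem hsS n) (S.pow_mem hsS n), ?_⟩
    have : (s ^ n * π) • ((s ^ n * π) • m) = (s ^ n * s ^ n) • ((π * π) • m) := by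
      rw [← mul_smul, ← mul_smul]
      congr 1
      ring
    rw [← this, hm]
  obtain ⟨k, rfl⟩ := Nat.exists_eq_succ_of_ne_zero hn.ne'
  rw [pow_succ, mul_assoc, mul_smul, mul_smul, hkill m hmK, smul_zero]

/-- Ogoma's lemma for rings: with `M = Λ/J` and everything written in `Λ`, the hypothesis
"`Ann(π) = Ann(π²)` in `S⁻¹(Λ/J)`" reads `sπ²y ∈ J ⇒ s′πy ∈ J`, and the conclusion gives
`s ∈ S` with `Ann_{Λ/J}(sπ) = Ann_{Λ/J}((sπ)²)`. [cite: StacksProject, Tag 07FC] -/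
theorem exists_mem_sq_mul_mem_imp [IsNoetherianRing A] (S : Submonoid A) (J : Ideal A) (π : A)
    (h : ∀ y : A, (∃ s ∈ S, s * (π * π * y) ∈ J) → ∃ s ∈ S, s * (π * y) ∈ J) :
    ∃ s ∈ S, ∀ y : A, (s * π) ^ 2 * y ∈ J → s * π * y ∈ J := by
  have key := exists_mem_smul_ann_eq_ann_sq (M := A ⧸ J) S π (fun m hm => by
    obtain ⟨y, rfl⟩ := Ideal.Quotient.mk_surjective m
    obtain ⟨s, hs, hsy⟩ := hm
    have hsy' : s * (π * π * y) ∈ J := by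
      rw [← Ideal.Quotient.eq_zero_iff_mem]
      simpa only [Algebra.smul_def, Ideal.Quotient.algebraMap_eq, ← map_mul, mul_assoc] using hsy
    obtain ⟨s', hs', hs'y⟩ := h y ⟨s, hs, hsy'⟩
    refine ⟨s', hs', ?_⟩
    rw [Algebra.smul_def, Algebra.smul_def, Ideal.Quotient.algebraMap_eq, ← map_mul, ← map_mul,
      Ideal.Quotient.eq_zero_iff_mem]
    exact hs'y)
  obtain ⟨s, hs, hs'⟩ := key
  refine ⟨s, hs, fun y hy => ?_⟩
  have h1 := hs' 1 Nat.one_pos (Ideal.Quotient.mk J y)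
  simp only [pow_one, Algebra.smul_def, Ideal.Quotient.algebraMap_eq, ← map_mul,
    Ideal.Quotient.eq_zero_iff_mem] at h1
  have := h1 (by simpa only [pow_two, mul_assoc] using hy)
  simpa only [mul_assoc] using this

/-- If `Ann(π) = Ann(π²)` modulo `J` (colon form) then `Ann(π) = Ann(πᶜ)` modulo `J` for every
`c > 0` (the parenthetical remark in the proof of Stacks, Lemma 07FE).
[cite: StacksProject, Tag 07FE] -/
theorem pow_mul_mem_imp_of_sq {J : Ideal A} {π : A} (h : ∀ y : A, π ^ 2 * y ∈ J → π * y ∈ J)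
    {c : ℕ} (hc : 0 < c) (y : A) (hy : π ^ c * y ∈ J) : π * y ∈ J := by
  induction c generalizing y with
  | zero => exact absurd hc (lt_irrefl 0)
  | succ c ih =>
    rcases Nat.eq_zero_or_pos c with rfl | hc'
    · simpa using hy
    · -- `π^{c+1} y = π^c (π y) ∈ J ⇒ π (π y) ∈ J ⇒ π y ∈ J`
      have h1 : π ^ c * (π * y) ∈ J := by
        simpa only [pow_succ, mul_assoc] using hy
      have h2 : π * (π * y) ∈ J := ih hc' (π * y) h1
      exact h y (by simpa only [pow_two, mul_assoc] using h2)

end Ogoma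

/-! ## Regular sequences: powers of an initial segment (Stacks 00LJ, 00LM) -/

section RegularPow

variable {R : Type u} [CommRing R] [IsLocalRing R] [IsNoetherianRing R]

/-- In a Noetherian local ring, if `x, x₂, …, x_r ∈ 𝔪` is weakly `M`-regular (`M` finite) then so
is `xⁿ, x₂, …, x_r` for `n > 0`: move `x` to the end (regular sequences in `𝔪` permute), replace
it by `xⁿ`, move it back. [cite: Matsumura1987, Thm. 16.1] -/
theorem isWeaklyRegular_cons_pow {M : Type v} [AddCommGroup M] [Module R M] [Module.Finite R M]
    {x : R} {rs : List R} (h : IsWeaklyRegular M (x :: rs))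
    (hmem : ∀ r ∈ x :: rs, r ∈ maximalIdeal R) {n : ℕ} (hn : 0 < n) :
    IsWeaklyRegular M (x ^ n :: rs) := by
  have h1 : IsWeaklyRegular M (rs ++ [x]) :=
    IsLocalRing.isWeaklyRegular_of_perm_of_subset_maximalIdeal h
      (List.perm_append_singleton x rs).symm hmem
  have h2 := (isWeaklyRegular_append_iff M rs [x]).mp h1
  have h3 : IsWeaklyRegular (M ⧸ (Ideal.ofList rs • ⊤ : Submodule R M)) [x ^ n] :=
    (isWeaklyRegular_singleton_iff _ _).mpr
      (((isWeaklyRegular_singleton_iff _ _).mp h2.2).pow n)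
  have h4 : IsWeaklyRegular M (rs ++ [x ^ n]) :=
    (isWeaklyRegular_append_iff M rs [x ^ n]).mpr ⟨h2.1, h3⟩
  have hmem' : ∀ r ∈ rs ++ [x ^ n], r ∈ maximalIdeal R := by
    intro r hr
    rcases List.mem_append.mp hr with hr | hr
    · exact hmem r (List.mem_cons_of_mem x hr)
    · rw [List.mem_singleton.mp hr]
      exact Ideal.pow_mem_of_mem _ (hmem x List.mem_cons_self) n hn
  exact IsLocalRing.isWeaklyRegular_of_perm_of_subset_maximalIdeal h4
    (List.perm_append_singleton (x ^ n) rs) hmem'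

/-- Raising every member of an initial segment of a weakly regular sequence in `𝔪` to the `n`-th
power (`n > 0`) keeps the sequence weakly regular. [cite: Matsumura1987, Thm. 16.1] -/
theorem isWeaklyRegular_map_pow_append {n : ℕ} (hn : 0 < n) :
    ∀ (rs₁ rs₂ : List R) (M : Type v) [AddCommGroup M] [Module R M] [Module.Finite R M],
      IsWeaklyRegular M (rs₁ ++ rs₂) → (∀ r ∈ rs₁ ++ rs₂, r ∈ maximalIdeal R) →
        IsWeaklyRegular M (rs₁.map (· ^ n) ++ rs₂) := by
  intro rs₁
  induction rs₁ with
  | nil => intro rs₂ M _ _ _ h _; simpa using h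
  | cons r rs₁ ih =>
    intro rs₂ M _ _ _ h hmem
    rw [List.cons_append, isWeaklyRegular_cons_iff] at h
    have hmem₂ : ∀ a ∈ rs₁ ++ rs₂, a ∈ maximalIdeal R := fun a ha =>
      hmem a (by rw [List.cons_append]; exact List.mem_cons_of_mem r ha)
    have ih' := ih rs₂ (QuotSMulTop r M) h.2 hmem₂
    have h' : IsWeaklyRegular M (r :: (rs₁.map (· ^ n) ++ rs₂)) :=
      (isWeaklyRegular_cons_iff M r _).mpr ⟨h.1, ih'⟩
    have hmem' : ∀ a ∈ r :: (rs₁.map (· ^ n) ++ rs₂), a ∈ maximalIdeal R := by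
      intro a ha
      rcases List.mem_cons.mp ha with rfl | ha
      · exact hmem a (by simp)
      · rcases List.mem_append.mp ha with ha | ha
        · obtain ⟨b, hb, rfl⟩ := List.mem_map.mp ha
          exact Ideal.pow_mem_of_mem _ (hmem₂ b (List.mem_append_left _ hb)) n hn
        · exact hmem₂ a (List.mem_append_right _ ha)
    simpa [List.map_cons] using isWeaklyRegular_cons_pow h' hmem' hn

omit [IsLocalRing R] [IsNoetherianRing R] in
/-- Colon form of regularity on `R/J`: if `x` is a non-zero-divisor on the `R`-module
`R ⧸ J•R` then `x y ∈ J ⇒ y ∈ J`. [folklore] -/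
theorem mem_of_mul_mem_of_isSMulRegular {J : Ideal R} {x : R}
    (h : IsSMulRegular (R ⧸ (J • ⊤ : Submodule R R)) x) {y : R} (hy : x * y ∈ J) : y ∈ J := by
  have hJ : (J • ⊤ : Submodule R R) = J := by
    rw [smul_eq_mul, Ideal.mul_top]
  have h0 : (Submodule.Quotient.mk (p := (J • ⊤ : Submodule R R)) y) = 0 := by
    refine h ?_
    change x • Submodule.Quotient.mk y = x • (0 : R ⧸ (J • ⊤ : Submodule R R))
    rw [smul_zero, ← Submodule.Quotient.mk_smul, (Submodule.Quotient.mk_eq_zero _).mpr]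
    rw [hJ, smul_eq_mul]
    exact hy
  rw [Submodule.Quotient.mk_eq_zero, hJ] at h0
  exact h0

end RegularPow

/-! ## Stacks 07FD: parameters at `𝔮` adapted to `I` -/

section Parameters

variable {Λ : Type u} [CommRing Λ]

/-- Unit multiples do not change the generated ideal. [folklore] -/
theorem span_range_mul_eq_of_isUnit {L : Type u} [CommRing L] {ι : Type*} (x u : ι → L)
    (hu : ∀ i, IsUnit (u i)) :
    Ideal.span (Set.range fun i => u i * x i) = Ideal.span (Set.range x) := by
  apply le_antisymm
  · rw [Ideal.span_le]
    rintro _ ⟨i, rfl⟩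
    exact Ideal.mul_mem_left _ _ (Ideal.subset_span ⟨i, rfl⟩)
  · rw [Ideal.span_le]
    rintro _ ⟨i, rfl⟩
    obtain ⟨v, hv⟩ := hu i
    have : x i = (↑v⁻¹ : L) * (u i * x i) := by
      rw [← mul_assoc, ← hv, Units.inv_mul, one_mul]
    rw [this]
    exact Ideal.mul_mem_left _ _ (Ideal.subset_span ⟨i, rfl⟩)

/-- The set underlying `((List.ofFn x).take i).map f` is `f ∘ x` applied to the indices `< i`.
[folklore] -/
theorem setOf_mem_map_take_ofFn {α β : Type*} {d : ℕ} (x : Fin d → α) (f : α → β)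
    (i : Fin d) :
    {b | b ∈ ((List.ofFn x).take i).map f} = (fun j => f (x j)) '' Set.Iio i := by
  ext b
  simp only [Set.mem_setOf_eq, List.mem_map, Set.mem_image, Set.mem_Iio]
  constructor
  · rintro ⟨a, ha, rfl⟩
    obtain ⟨k, hk, rfl⟩ := List.mem_iff_getElem.mp ha
    have hk' : k < i := by
      rw [List.length_take, List.length_ofFn] at hk
      exact (lt_min_iff.mp hk).1
    refine ⟨⟨k, hk'.trans i.isLt⟩, hk', ?_⟩
    rw [List.getElem_take, List.getElem_ofFn]
  · rintro ⟨j, hj, rfl⟩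
    refine ⟨x j, ?_, rfl⟩
    refine List.mem_iff_getElem.mpr ⟨j, ?_, ?_⟩
    · rw [List.length_take, List.length_ofFn]
      exact lt_min hj j.isLt
    · rw [List.getElem_take, List.getElem_ofFn]

/-- In a regular local ring `L` of dimension `d`, if `x₁, …, x_d` generate `𝔪` then for every
`t` and `e > 0` the element `x_t` is a non-zero-divisor modulo `(x_jᵉ : j < t)`: the regular
system of parameters is a regular sequence (Matsumura 17.8, `isRegular_of_span_eq_maximalIdeal`)
and powers of an initial segment keep it regular (Matsumura 16.1).
[cite: Matsumura1987, Thm. 17.8 and Thm. 16.1] -/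
theorem mem_span_pow_of_mul_mem {L : Type u} [CommRing L] [IsRegularLocalRing L] {d : ℕ}
    (x : Fin d → L) (hx : Ideal.span (Set.range x) = maximalIdeal L)
    (hd : ringKrullDim L = d) {e : ℕ} (he : 0 < e) (t : Fin d) (y : L)
    (hy : x t * y ∈ Ideal.span ((fun j => x j ^ e) '' Set.Iio t)) :
    y ∈ Ideal.span ((fun j => x j ^ e) '' Set.Iio t) := by
  -- the r.s.o.p. is a regular sequence
  have hspan : Ideal.ofList (List.ofFn x) = maximalIdeal L := by
    rw [Ideal.ofList, ← hx]
    congr 1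
    ext a
    simp [List.mem_ofFn, Set.mem_range]
  have hlen : ((List.ofFn x).length : WithBot ℕ∞) = ringKrullDim L := by
    rw [List.length_ofFn, hd]
  have hreg : IsRegular L (List.ofFn x) := isRegular_of_span_eq_maximalIdeal L _ hspan hlen
  have hmem : ∀ r ∈ List.ofFn x, r ∈ maximalIdeal L := fun r hr => by
    rw [← hx]
    obtain ⟨j, rfl⟩ := List.mem_ofFn.mp hr
    exact Ideal.subset_span ⟨j, rfl⟩
  -- split the list at `t`
  have hsplit : List.ofFn x = (List.ofFn x).take t ++ (x t :: (List.ofFn x).drop (t + 1)) := by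
    conv_lhs => rw [← List.take_append_drop t (List.ofFn x)]
    congr 1
    rw [List.drop_eq_getElem_cons (by rw [List.length_ofFn]; exact t.isLt), List.getElem_ofFn]
  have hw : IsWeaklyRegular L ((List.ofFn x).take t ++ (x t :: (List.ofFn x).drop (t + 1))) :=
    hsplit ▸ hreg.toIsWeaklyRegular
  have hmem' : ∀ r ∈ (List.ofFn x).take t ++ (x t :: (List.ofFn x).drop (t + 1)),
      r ∈ maximalIdeal L := fun r hr => hmem r (hsplit ▸ hr)
  have hpow := isWeaklyRegular_map_pow_append he _ _ L hw hmem'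
  rw [isWeaklyRegular_append_iff, isWeaklyRegular_cons_iff] at hpow
  have hreg_t := hpow.2.1
  -- identify the ideal `ofList (take t |>.map (^e))` with the span over `Iio t`
  have hJ : Ideal.ofList (((List.ofFn x).take t).map (· ^ e)) =
      Ideal.span ((fun j => x j ^ e) '' Set.Iio t) := by
    rw [Ideal.ofList, setOf_mem_map_take_ofFn]
  rw [hJ] at hreg_t
  exact mem_of_mul_mem_of_isSMulRegular hreg_t hy

/-- Transfer of the colon condition from `Λ_𝔮` to `Λ` up to an element of `S = Λ ∖ 𝔮`: if
`x_t = πₜ/1` is a non-zero-divisor modulo `(πⱼᵉ : j < t)Λ_𝔮`, then `sπₜ²y ∈ J ⇒ s′πₜy ∈ J`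
in `Λ` for `J = (πⱼᵉ : j < t)`, which is the hypothesis of Ogoma's lemma. [folklore] -/
theorem exists_mul_mem_of_regular_atPrime (q : Ideal Λ) [q.IsPrime] {d : ℕ} (π : Fin d → Λ)
    {e : ℕ} (t : Fin d)
    (hreg : ∀ z : Localization.AtPrime q,
      algebraMap Λ _ (π t) * z ∈
          Ideal.span ((fun j => algebraMap Λ (Localization.AtPrime q) (π j) ^ e) '' Set.Iio t) →
        z ∈ Ideal.span ((fun j => algebraMap Λ (Localization.AtPrime q) (π j) ^ e) '' Set.Iio t))
    (y : Λ) (hy : ∃ s ∈ q.primeCompl, s * (π t * π t * y) ∈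
      Ideal.span ((fun j => π j ^ e) '' Set.Iio t)) :
    ∃ s ∈ q.primeCompl, s * (π t * y) ∈ Ideal.span ((fun j => π j ^ e) '' Set.Iio t) := by
  set L := Localization.AtPrime q
  set J : Ideal Λ := Ideal.span ((fun j => π j ^ e) '' Set.Iio t) with hJ_def
  have hJL : J.map (algebraMap Λ L) =
      Ideal.span ((fun j => algebraMap Λ L (π j) ^ e) '' Set.Iio t) := by
    rw [hJ_def, Ideal.map_span, ← Set.image_comp]
    congr 1
    ext j
    simp
  obtain ⟨s, hs, hsy⟩ := hy
  -- in `L`: `(s/1) x_t² (y/1) ∈ JL`, and `s/1` is a unit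
  have h1 : algebraMap Λ L (π t) * (algebraMap Λ L (π t) * algebraMap Λ L y) ∈ J.map (algebraMap Λ L) := by
    have hu : IsUnit (algebraMap Λ L s) := IsLocalization.map_units L (⟨s, hs⟩ : q.primeCompl)
    have h0 := Ideal.mem_map_of_mem (algebraMap Λ L) hsy
    rw [map_mul] at h0
    have h0' := (Ideal.unit_mul_mem_iff_mem _ hu).mp h0
    simpa only [map_mul, mul_assoc] using h0'
  rw [hJL] at h1
  have h2 := hreg _ (hreg _ h1)
  rw [← hJL, IsLocalization.mem_map_algebraMap_iff q.primeCompl L] at h2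
  obtain ⟨⟨⟨a, ha⟩, ⟨u, hu⟩⟩, hau⟩ := h2
  simp only at hau
  rw [← map_mul, IsLocalization.eq_iff_exists q.primeCompl L] at hau
  obtain ⟨⟨c, hc⟩, hc'⟩ := hau
  simp only at hc'
  refine ⟨c * u, q.primeCompl.mul_mem hc hu, ?_⟩
  have : c * u * (π t * y) = π t * (c * (y * u)) := by ring
  rw [this, hc']
  exact J.mul_mem_left _ (J.mul_mem_left _ ha)

/-- **Stacks, Lemma 07FD.** Let `Λ` be a Noetherian ring, `I ⊆ Λ` an ideal, `𝔮 ⊆ Λ` a prime,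
`n, e > 0`; assume `𝔮ⁿΛ_𝔮 ⊆ IΛ_𝔮` and that `Λ_𝔮` is a regular local ring of dimension `d`. Then
there are `π₁, …, π_d ∈ Λ` such that (1) `(π₁, …, π_d)Λ_𝔮 = 𝔮Λ_𝔮`, (2) `πᵢⁿ ∈ I` for all `i`, and
(3) for every `i`, `Ann_{Λ/(π₁ᵉ, …, πᵢ₋₁ᵉ)Λ}(πᵢ) = Ann_{Λ/(π₁ᵉ, …, πᵢ₋₁ᵉ)Λ}(πᵢ²)` (colon form).
[cite: StacksProject, Tag 07FD] -/
theorem exists_parameters_pow_mem_ann_eq [IsNoetherianRing Λ] (I q : Ideal Λ) [q.IsPrime]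
    [IsRegularLocalRing (Localization.AtPrime q)] {n e : ℕ} (hn : 0 < n) (he : 0 < e)
    (hqI : (q ^ n).map (algebraMap Λ (Localization.AtPrime q)) ≤
      I.map (algebraMap Λ (Localization.AtPrime q)))
    {d : ℕ} (hd : ringKrullDim (Localization.AtPrime q) = d) :
    ∃ π : Fin d → Λ,
      (Ideal.span (Set.range π)).map (algebraMap Λ (Localization.AtPrime q)) =
          maximalIdeal (Localization.AtPrime q) ∧
      (∀ i, π i ^ n ∈ I) ∧
      ∀ (i : Fin d) (y : Λ), π i ^ 2 * y ∈ Ideal.span ((fun j => π j ^ e) '' Set.Iio i) →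
        π i * y ∈ Ideal.span ((fun j => π j ^ e) '' Set.Iio i) := by
  classical
  set L := Localization.AtPrime q with hL
  set S := q.primeCompl with hS
  -- `d = emb dim Λ_𝔮`
  have hsf : (maximalIdeal L).spanFinrank = d := by
    have h1 := IsRegularLocalRing.spanFinrank_maximalIdeal (R := L)
    rw [hd] at h1
    exact_mod_cast h1
  -- generators of `𝔮Λ_𝔮` …
  obtain ⟨s₀, hs₀card, hs₀span⟩ := Submodule.FG.exists_span_finset_card_eq_spanFinrank
    (maximalIdeal L).fg_of_isNoetherianRing
  rw [hsf] at hs₀card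
  let x₀ : Fin d → L := fun i => (s₀.equivFin.symm (Fin.cast hs₀card.symm i) : L)
  have hx₀ : Ideal.span (Set.range x₀) = maximalIdeal L := by
    have : Set.range x₀ = (s₀ : Set L) := by
      ext y
      simp only [Set.mem_range, Finset.mem_coe, x₀]
      constructor
      · rintro ⟨i, rfl⟩
        exact Finset.coe_mem _
      · intro hy
        exact ⟨Fin.cast hs₀card (s₀.equivFin ⟨y, hy⟩), by simp⟩
    rw [this]
    exact hs₀span
  -- … lifted to `Λ` (clear denominators: unit multiples generate the same ideal)
  have hsurj := fun i => IsLocalization.surj S (x₀ i)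
  choose p hp using hsurj
  -- the invariant kept through the construction
  let Good : (Fin d → Λ) → Prop := fun π =>
    Ideal.span (Set.range fun i => algebraMap Λ L (π i)) = maximalIdeal L
  have good_mul : ∀ (π : Fin d → Λ) (c : Fin d → Λ), (∀ i, c i ∈ S) → Good π →
      Good (fun i => c i * π i) := by
    intro π c hc hg
    change Ideal.span (Set.range fun i => algebraMap Λ L (c i * π i)) = maximalIdeal L
    simp_rw [map_mul]
    rw [span_range_mul_eq_of_isUnit (fun i => algebraMap Λ L (π i)) (fun i => algebraMap Λ L (c i))
      (fun i => IsLocalization.map_units L ⟨c i, hc i⟩)]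
    exact hg
  have good_mem : ∀ π : Fin d → Λ, Good π → ∀ i, π i ∈ q := by
    intro π hg i
    rw [← IsLocalization.AtPrime.to_map_mem_maximal_iff L q (π i)]
    change algebraMap Λ L (π i) ∈ maximalIdeal L
    rw [← hg]
    exact Ideal.subset_span ⟨i, rfl⟩
  let π₀ : Fin d → Λ := fun i => (p i).1
  have hgood₀ : Good π₀ := by
    change Ideal.span (Set.range fun i => algebraMap Λ L (p i).1) = maximalIdeal L
    have : (fun i => algebraMap Λ L (p i).1) = fun i => algebraMap Λ L ((p i).2 : Λ) * x₀ i := by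
      ext i
      rw [← hp i, mul_comm]
    rw [this, span_range_mul_eq_of_isUnit x₀ _ (fun i => IsLocalization.map_units L (p i).2)]
    exact hx₀
  -- (2): multiply by elements of `S` to get `πᵢⁿ ∈ I`
  have hpowI : ∀ π : Fin d → Λ, Good π → ∀ i, ∃ s ∈ S, s * π i ^ n ∈ I := by
    intro π hg i
    have hq : π i ^ n ∈ q ^ n := Ideal.pow_mem_pow (good_mem π hg i) n
    have hL' : algebraMap Λ L (π i ^ n) ∈ I.map (algebraMap Λ L) :=
      hqI (Ideal.mem_map_of_mem _ hq)
    rw [IsLocalization.mem_map_algebraMap_iff S L] at hL'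
    obtain ⟨⟨⟨a, ha⟩, ⟨u, hu⟩⟩, hau⟩ := hL'
    simp only at hau
    rw [← map_mul, IsLocalization.eq_iff_exists S L] at hau
    obtain ⟨⟨c, hc⟩, hc'⟩ := hau
    simp only at hc'
    refine ⟨c * u, S.mul_mem hc hu, ?_⟩
    have : c * u * π i ^ n = c * (π i ^ n * u) := by ring
    rw [this, hc']
    exact I.mul_mem_left _ ha
  choose! σ hσS hσI using hpowI π₀ hgood₀
  let π₁ : Fin d → Λ := fun i => σ i * π₀ i
  have hgood₁ : Good π₁ := good_mul π₀ σ hσS hgood₀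
  have hI₁ : ∀ i, π₁ i ^ n ∈ I := by
    intro i
    change (σ i * π₀ i) ^ n ∈ I
    obtain ⟨k, hk⟩ := Nat.exists_eq_succ_of_ne_zero hn.ne'
    rw [mul_pow, hk, pow_succ, mul_assoc, ← hk]
    exact I.mul_mem_left _ (hσI i)
  -- (3) by induction on `t`, using Ogoma's lemma at each step
  have step : ∀ t : ℕ, t ≤ d → ∃ π : Fin d → Λ, Good π ∧ (∀ i, π i ^ n ∈ I) ∧
      ∀ i : Fin d, (i : ℕ) < t → ∀ y : Λ,
        π i ^ 2 * y ∈ Ideal.span ((fun j => π j ^ e) '' Set.Iio i) →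
          π i * y ∈ Ideal.span ((fun j => π j ^ e) '' Set.Iio i) := by
    intro t
    induction t with
    | zero => exact fun _ => ⟨π₁, hgood₁, hI₁, fun i hi => absurd hi (Nat.not_lt_zero _)⟩
    | succ t ih =>
      intro ht
      obtain ⟨π, hg, hI, h3⟩ := ih (Nat.le_of_succ_le ht)
      have htd : t < d := Nat.lt_of_succ_le ht
      set i₀ : Fin d := ⟨t, htd⟩ with hi₀
      -- regularity of `x_{t}` modulo `(x_jᵉ : j < t)` in `Λ_𝔮`
      have hregL := mem_span_pow_of_mul_mem (fun i => algebraMap Λ L (π i)) hg hd he i₀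
      -- Ogoma
      obtain ⟨s, hs, hs3⟩ := exists_mem_sq_mul_mem_imp S
        (Ideal.span ((fun j => π j ^ e) '' Set.Iio i₀)) (π i₀)
        (fun y hy => exists_mul_mem_of_regular_atPrime q π i₀ hregL y hy)
      -- the new family
      let π' : Fin d → Λ := Function.update π i₀ (s * π i₀)
      have hπ'_eq : ∀ j : Fin d, j ≠ i₀ → π' j = π j := fun j hj => Function.update_of_ne hj _ _
      have hπ'_i₀ : π' i₀ = s * π i₀ := Function.update_self _ _ _
      have hπ'_mul : π' = fun i => (if i = i₀ then s else 1) * π i := by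
        ext i
        by_cases hi : i = i₀
        · subst hi; rw [hπ'_i₀, if_pos rfl]
        · rw [hπ'_eq i hi, if_neg hi, one_mul]
      -- spans over `Iio i` for `i ≤ i₀` are unchanged
      have hJ_eq : ∀ i : Fin d, (i : ℕ) ≤ t →
          Ideal.span ((fun j => π' j ^ e) '' Set.Iio i) =
            Ideal.span ((fun j => π j ^ e) '' Set.Iio i) := by
        intro i hi
        congr 1
        refine Set.image_congr fun j hj => ?_
        have hj' : j ≠ i₀ := by
          intro hji
          rw [Set.mem_Iio, hji, Fin.lt_def] at hj
          exact absurd (lt_of_lt_of_le hj hi) (lt_irrefl _)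
        rw [hπ'_eq j hj']
      refine ⟨π', ?_, ?_, ?_⟩
      · rw [hπ'_mul]
        refine good_mul π _ (fun i => ?_) hg
        split_ifs
        · exact hs
        · exact S.one_mem
      · intro i
        by_cases hi : i = i₀
        · subst hi
          rw [hπ'_i₀, mul_pow]
          exact I.mul_mem_left _ (hI _)
        · rw [hπ'_eq i hi]
          exact hI i
      · intro i hi y hy
        rcases Nat.lt_succ_iff_lt_or_eq.mp hi with hlt | heq
        · -- old indices
          have hne : i ≠ i₀ := fun h => by
            rw [h] at hlt; exact lt_irrefl _ hlt
          rw [hJ_eq i hlt.le, hπ'_eq i hne] at hy ⊢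
          exact h3 i hlt y hy
        · -- the new index `i₀`
          have hi' : i = i₀ := Fin.ext heq
          subst hi'
          rw [hJ_eq _ le_rfl, hπ'_i₀] at hy ⊢
          exact hs3 y hy
  obtain ⟨π, hg, hI, h3⟩ := step d le_rfl
  refine ⟨π, ?_, hI, fun i y hy => h3 i i.isLt y hy⟩
  rw [Ideal.map_span, ← Set.range_comp]
  exact hg

/-- The first line of the proof of Stacks, Lemma 07FE: if `𝔮` is minimal over `𝔥` (in a
Noetherian ring) then `𝔮ⁿΛ_𝔮 ⊆ 𝔥Λ_𝔮` for some `n > 0` — the radical of `𝔥Λ_𝔮` is the maximal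
ideal `𝔮Λ_𝔮`. [cite: StacksProject, Tag 07FE] -/
theorem exists_pow_map_le_map_of_mem_minimalPrimes [IsNoetherianRing Λ] (J q : Ideal Λ) [q.IsPrime]
    (hq : q ∈ J.minimalPrimes) :
    ∃ n : ℕ, 0 < n ∧ (q ^ n).map (algebraMap Λ (Localization.AtPrime q)) ≤
      J.map (algebraMap Λ (Localization.AtPrime q)) := by
  set L := Localization.AtPrime q
  have hmax : q.map (algebraMap Λ L) = maximalIdeal L := Localization.AtPrime.map_eq_maximalIdeal
  -- `𝔪 ≤ √(JL)`: every prime over `JL` pulls back to a prime between `J` and `𝔮`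
  have hle : maximalIdeal L ≤ (J.map (algebraMap Λ L)).radical := by
    rw [Ideal.radical_eq_sInf, le_sInf_iff]
    rintro P ⟨hJP, hP⟩
    have hp : (P.comap (algebraMap Λ L)).IsPrime := Ideal.IsPrime.comap _
    have hJp : J ≤ P.comap (algebraMap Λ L) :=
      (Ideal.le_comap_map).trans (Ideal.comap_mono hJP)
    have hpq : P.comap (algebraMap Λ L) ≤ q := by
      intro a ha
      by_contra haq
      have hu : IsUnit (algebraMap Λ L a) :=
        IsLocalization.map_units L (⟨a, show a ∈ q.primeCompl from haq⟩ : q.primeCompl)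
      exact hP.ne_top (Ideal.eq_top_of_isUnit_mem _ ha hu)
    have hqp : q ≤ P.comap (algebraMap Λ L) := hq.2 ⟨hp, hJp⟩ hpq
    rw [← hmax]
    exact (Ideal.map_mono hqp).trans Ideal.map_comap_le
  obtain ⟨k, hk⟩ := Ideal.exists_pow_le_of_le_radical_of_fg hle
    (maximalIdeal L).fg_of_isNoetherianRing
  refine ⟨k + 1, Nat.succ_pos k, ?_⟩
  rw [Ideal.map_pow, hmax, pow_succ]
  exact Ideal.mul_le_right.trans hk

end Parameters

end Literature.AlgebraicGeometry.Resolution
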